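import Literature.GroupTheory.CombinatorialGroupTheory.PuncturedSurfaceGroupNodeTwist
import Literature.AnabelianGeometry.SemiGraphs.PSCSeparatingCoveringsClosedSurfaceOrigin
import Literature.AnabelianGeometry.SemiGraphs.PSCTwoComponentUnmarkedEdges
import HarnessLib

/-!
# [CombGC] Prop. 1.2, proof p. 9: EDGE-LIKE separating coverings at the closed-surface carrier `Π = Γ̂_{g,0}` (two unmarked components) — the node

Mochizuki, *A combinatorial version of the Grothendieck conjecture*, Tohoku Math. J. **59** (2007) [CombGC],
PROOF of Prop. 1.2, p. 9, the resp'd (edge) case: "there exists a finite étale … `Π_G`-covering `G' → G` whose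
restriction to the anabelioid `G_{e₂}` is trivial …, but whose restriction to the anabelioid `G_{e₁}` is
nontrivial.  But, in light of our assumption that `G` is sturdy, one verifies immediately that by gluing together
appropriate finite étale coverings of the anabelioids `G_v`, `G_e`, one may construct a finite étale covering
`G' → G` with the desired properties" [cite: MochizukiCombGC2007, Prop 1.2 proof p.9], typed LEVEL-WISE as
`PSCDatum.EdgeLikeSeparatingCoverings` (row P12-L01-E of `SUBDAG-CombGC-Prop12.md`; instance form of abc-iut
FACT-LIST row F-2827), with Prop. 1.2 (i)/(ii) via abc-iut-w5-d183's reductions (`prop12_of_separating`).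

PROOF-ONLY file (abc-iut-f-060 gen 9; row «NODE-RESIDUAL@UNMARKED» of abc-iut-L3-lead γ85; 0 definitions).  The
carrier: a two-component one-node datum with BOTH components unmarked (`r = 0`), `Π` a pro-`Σ` completion of the
CLOSED surface group `Γ_{g,0} = A *_{⟨ε⟩} B`, node group `cl ι⟨ε⟩`, `ε = ∏_{i<g₀}[a_i,b_i] ∈ [Γ,Γ]` — the carrier
at which every abelian / free-factor / cut-off engine of the cell is blind (the vertex rows there are
`PSCSeparatingCoveringsClosedSurface(Origin).lean`, the node was HONEST-OPEN).  The node is decided by the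
NON-ABELIAN node twist `PuncturedSurfaceGroup.exists_levelHom_nodeTwist` (Heisenberg covers of the two level
vertices adjacent to the chosen level node, glued; `PuncturedSurfaceGroupNodeTwist.lean`):

* `PuncturedSurfaceGroup.exists_normal_separating_nodeTwist` — the separating level `Ker ψ ⊴ ι⁻¹(V)` in the
  output shape of abc-iut-w5-d047's `IsProSigmaCompletion.exists_open_unrSeparating_of_discrete`;
* `IsProSigmaCompletion.nodeTwist_exists_open_separating_sameNode` — two DISTINCT level nodes `Vγ₁cl ι⟨x⟩ ≠
  Vγ₂cl ι⟨x⟩` over the node are separated by an open `U ≤ V`, normal in `V` (`ℓ ∈ Σ`, Heisenberg group mod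
  `ℓ^{[Γ:K]³}`, transfer along the completion);
* `edgeLikeSeparatingCoverings_of_twoComponentClosed` — ★ F-2827 (`V' := V`) at EVERY such datum;
  `separatingCoverings_of_twoComponentClosed` (F-2829: with F-2826 of abc-iut-w5-d183 and F-2828 of
  abc-iut-f-164), `prop12_of_twoComponentClosed` — ALL FIVE typed clauses of Prop. 1.2 (i)/(ii) there, in
  particular the node is COMMENSURABLY TERMINAL;
* `twoComponentClosedOrigin_prop12_rows` — F-0438 (both clauses), F-0459, F-2830 at every origin of such data;
  `exists_twoComponentClosedOrigin_prop12_holds_all` — NON-VACUOUSLY (the origin is inhabited for every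
  nonempty set `Σ` of primes and all genera `g₀, g₁ ≥ 1`, e.g. the unpointed genus-2 curve `Δ₁ ⊂ ∂M̄₂`).

Instance forms at data of the shape of genuine stable curves; consistency evidence for the typed rows, not the
printed theorems for all stable curves.  Nothing here takes a side on [IUTchIII] Cor. 3.12.
-/

noncomputable section

/-! ### The separating level of the node twist (discrete packaging) -/

namespace Literature.GroupTheory.CombinatorialGroupTheory.PuncturedSurfaceGroup

open scoped Pointwise

variable {g r : ℕ}

/-- **Separating level for the node** ([CombGC] Prop. 1.2 proof p. 9, edge case, discrete form): in the setting of
`exists_levelHom_nodeTwist` with `M` finite, some `U ⊴ N` with `[N : U] ∣ |M|` misses an element of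
`f₁⟨x⟩f₁⁻¹ ∩ N` and contains `f₂⟨x⟩f₂⁻¹ ∩ N` whenever `f₁⁻¹ f₂ ∉ ⟨x⟩·N` (every OTHER level node over the node).
Output shape of the discrete suppliers of `IsProSigmaCompletion.exists_open_unrSeparating_of_discrete`.
[cite: MochizukiCombGC2007, Prop 1.2 proof p.9] -/
theorem exists_normal_separating_nodeTwist {g₀ : ℕ} (hg₀ : 1 ≤ g₀) (hg : g₀ + 1 ≤ g)
    (x : PuncturedSurfaceGroup g r)
    (hx : x = ((List.finRange g).map fun i : Fin g => if (i : ℕ) < g₀ then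
      a (r := r) i * b i * (a i)⁻¹ * (b i)⁻¹ else 1).prod)
    (N : Subgroup (PuncturedSurfaceGroup g r)) [hN : N.Normal] [N.FiniteIndex]
    {M : Type*} [Group M] [Finite M] {X Y Z : M} (hXYZ : X * Y * X⁻¹ * Y⁻¹ = Z)
    (hZ : Z ∈ Subgroup.center M) {q : ℕ} (hZq : ∀ m : ℕ, Z ^ m = 1 ↔ q ∣ m) (hq : N.index ^ 3 < q)
    (f₁ : PuncturedSurfaceGroup g r) :
    ∃ U : Subgroup N, U.Normal ∧ U.index ∣ Nat.card M ∧ U.FiniteIndex ∧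
      (∃ z ∈ (ConjAct.toConjAct f₁ • Subgroup.zpowers x) ⊓ N, z ∉ U.map N.subtype) ∧
      ∀ f₂ : PuncturedSurfaceGroup g r,
        f₁⁻¹ * f₂ ∉ (Subgroup.zpowers x : Set (PuncturedSurfaceGroup g r)) *
            (N : Set (PuncturedSurfaceGroup g r)) →
        (ConjAct.toConjAct f₂ • Subgroup.zpowers x) ⊓ N ≤ U.map N.subtype := by
  classical
  obtain ⟨ψ, halive, hkill⟩ := exists_levelHom_nodeTwist hg₀ hg x hx N hXYZ hZ hZq hq f₁
  refine ⟨ψ.ker, inferInstance, ?_, ?_, ?_, ?_⟩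
  · rw [Subgroup.index_ker]
    exact Subgroup.card_subgroup_dvd_card ψ.range
  · exact ⟨fun h0 => (Nat.card_pos (α := ψ.range)).ne' (by rwa [Subgroup.index_ker] at h0)⟩
  · refine ⟨f₁ * x ^ N.index * f₁⁻¹, Subgroup.mem_inf.mpr ⟨?_, hN.conj_mem _ (Subgroup.pow_index_mem N x) f₁⟩,
      fun hmem => ?_⟩
    · rw [Subgroup.mem_smul_pointwise_iff_exists]
      exact ⟨x ^ N.index, Subgroup.npow_mem_zpowers x _, by
        rw [ConjAct.smul_def, ConjAct.ofConjAct_toConjAct]⟩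
    · obtain ⟨u, hu, hu'⟩ := Subgroup.mem_map.mp hmem
      refine halive ?_
      rw [← show u = ⟨f₁ * x ^ N.index * f₁⁻¹, hN.conj_mem _ (Subgroup.pow_index_mem N x) f₁⟩ from
        Subtype.ext hu']
      exact hu
  · intro f₂ hf₂ z hz
    exact Subgroup.mem_map.mpr ⟨⟨z, hz.2⟩, hkill f₂ hf₂ z hz, rfl⟩

end Literature.GroupTheory.CombinatorialGroupTheory.PuncturedSurfaceGroup

namespace Literature.AnabelianGeometry.SemiGraphs

open scoped Pointwise
open Literature.AnabelianGeometry.Anabelioids (IsSigmaInteger)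
open Literature.GroupTheory.CombinatorialGroupTheory
open Literature.GroupTheory.CombinatorialGroupTheory.PuncturedSurfaceGroup (a b c exists_normal_separating_nodeTwist)


/-! ### The same-node separating covering from the node twist -/

namespace SemiGraphOfAnabelioids.IsProSigmaCompletion

variable {Sigma : Set ℕ} {g r : ℕ} {P : Type*} [Group P] [TopologicalSpace P] [IsTopologicalGroup P]
  [CompactSpace P] [TotallyDisconnectedSpace P] {ι : PuncturedSurfaceGroup g r →* P}

/-- **[CombGC] Prop. 1.2, proof p. 9 — the edge-like separating covering at the NODE, node-twist form.**
`ι : Γ_{g,r} → Π` a pro-`Σ` completion (`Π` profinite; any `r`, in particular `r = 0`), `x = ∏_{i<g₀}[a_i,b_i]`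
(`1 ≤ g₀ ≤ g − 1`) the node loop, `A = cl ι⟨x⟩` the node group, `ℓ ∈ Σ` prime, `V ⊴ Π` open.  Then two DISTINCT
level nodes `Vγ₁A ≠ Vγ₂A` are separated by an open `U ≤ V`, normal in `V`, with `γ₂Aγ₂⁻¹ ∩ V ≤ U` and
`γ₁Aγ₁⁻¹ ∩ V ⊄ U` (discrete node twist at `K = ι⁻¹(V)` with values in the Heisenberg group mod `ℓ^{[Γ:K]³}`;
transfer along the completion `V` of `K`). [cite: MochizukiCombGC2007, Prop 1.2 proof p.9] -/
theorem nodeTwist_exists_open_separating_sameNode (hι : IsProSigmaCompletion Sigma ι)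
    {g₀ : ℕ} (hg₀ : 1 ≤ g₀) (hg : g₀ + 1 ≤ g) (x : PuncturedSurfaceGroup g r)
    (hx : x = ((List.finRange g).map fun i : Fin g => if (i : ℕ) < g₀ then
      a (r := r) i * b i * (a i)⁻¹ * (b i)⁻¹ else 1).prod)
    {ℓ : ℕ} (hℓ : ℓ.Prime) (hℓS : ℓ ∈ Sigma)
    (A : Subgroup P) (hA : A = ((Subgroup.zpowers x).map ι).topologicalClosure)
    (V : Subgroup P) [hVn : V.Normal] (hVo : IsOpen (V : Set P)) (γ₁ γ₂ : ConjAct P)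
    (hne : DoubleCoset.doubleCoset (ConjAct.ofConjAct γ₁) (V : Set P) (A : Set P) ≠
      DoubleCoset.doubleCoset (ConjAct.ofConjAct γ₂) (V : Set P) (A : Set P)) :
    ∃ U : Subgroup P, IsOpen (U : Set P) ∧ U ≤ V ∧ (U.subgroupOf V).Normal ∧
      (γ₂ • A) ⊓ V ≤ U ∧ ¬ ((γ₁ • A) ⊓ V ≤ U) := by
  classical
  haveI hKfi : (V.comap ι).FiniteIndex := finiteIndex_comap hι V hVo
  set m : ℕ := (V.comap ι).index with hm
  have hmpos : 0 < m := Nat.pos_of_ne_zero Subgroup.FiniteIndex.index_ne_zero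
  -- the Heisenberg group mod `q = ℓ^{m³}`
  set q : ℕ := ℓ ^ (m ^ 3) with hq
  have hmq : m ^ 3 < q := Nat.lt_pow_self hℓ.one_lt
  obtain ⟨φ, X, Y, Z, hXYZ, hZc, hZq, hcard⟩ := Heisenberg.exists_heisenbergTriple_central q
  haveI : Finite (Multiplicative (ZMod q × ZMod q) ⋊[φ] Multiplicative (ZMod q)) :=
    Nat.finite_of_card_ne_zero (by rw [hcard]; exact pow_ne_zero _ (pow_ne_zero _ hℓ.ne_zero))
  -- representatives of the two level nodes in `ι(Γ)`, up to `V`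
  obtain ⟨f₁, w₁, hw₁, -, hA₁, hdc₁⟩ := exists_rep_unr hι A ⊥ V hVo γ₁
  obtain ⟨f₂, w₂, hw₂, -, hA₂, hdc₂⟩ := exists_rep_unr hι A ⊥ V hVo γ₂
  rw [sup_bot_eq] at hdc₁ hdc₂
  -- distinct level nodes: `f₁⁻¹ f₂ ∉ ⟨x⟩ · K`
  have hδ : f₁⁻¹ * f₂ ∉ (Subgroup.zpowers x : Set (PuncturedSurfaceGroup g r)) * (V.comap ι : Set _) := by
    intro hmem
    obtain ⟨a', ha', k, hk, hak⟩ := Set.mem_mul.mp hmem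
    apply hne
    rw [hdc₁, hdc₂]
    symm
    have hkV : ι k ∈ V := hk
    have haA : ι a' ∈ A := by rw [hA]; exact Subgroup.le_topologicalClosure _ (Subgroup.mem_map_of_mem ι ha')
    refine DoubleCoset.doubleCoset_eq_of_mem (DoubleCoset.mem_doubleCoset.mpr
      ⟨ι f₁ * ι a' * ι k * (ι f₁ * ι a')⁻¹, hVn.conj_mem _ hkV (ι f₁ * ι a'), ι a', haA, ?_⟩)
    have hf₂ : f₂ = f₁ * (a' * k) := by rw [hak, mul_inv_cancel_left]
    rw [hf₂, map_mul, map_mul]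
    group
  -- the node twist at the discrete level `K = ι⁻¹(V)`
  obtain ⟨U', hU'n, hidx, hfi, halive, hkill⟩ :=
    exists_normal_separating_nodeTwist hg₀ hg x hx (V.comap ι) hXYZ hZc hZq (by rw [← hm]; exact hmq) f₁
  haveI := hU'n
  have hU'S : IsSigmaInteger Sigma U'.index := by
    rw [hcard, hq, ← pow_mul] at hidx
    exact ⟨Nat.pos_of_ne_zero hfi.index_ne_zero, fun p hp hpd =>
      (isSigmaInteger_prime_pow hℓ hℓS _).2 p hp (hpd.trans hidx)⟩
  -- transfer along the completion `V` of `K`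
  obtain ⟨U, hUo, hUV, hUn, hk, ha⟩ := exists_open_unrSeparating_of_discrete hι (Subgroup.zpowers x)
    (Subgroup.zpowers x) ⊥ V hVo f₁ f₂ U' hU'S (by rw [sup_bot_eq]; exact hkill f₂ hδ) halive
  haveI := hUn
  refine ⟨U, hUo, hUV, hUn, ?_, ?_⟩
  · rw [hA₂, ← conjAct_smul_eq_of_subgroupOf_normal hUV hw₂, Subgroup.pointwise_smul_le_pointwise_smul_iff]
    exact le_trans (inf_le_inf_right V (by rw [hA]; exact le_sup_left)) hk
  · rw [hA₁, ← conjAct_smul_eq_of_subgroupOf_normal hUV hw₁, Subgroup.pointwise_smul_le_pointwise_smul_iff, hA]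
    exact ha

end SemiGraphOfAnabelioids.IsProSigmaCompletion

/-! ### The closed-surface carrier: two unmarked components, one node -/

namespace PSCDatum

open SemiGraphOfAnabelioids (IsProSigmaCompletion)
open SemiGraphOfAnabelioids.IsProSigmaCompletion (nodeTwist_exists_open_separating_sameNode)

variable {P : Type} [Group P] [TopologicalSpace P] [IsTopologicalGroup P]
variable [CompactSpace P] [TotallyDisconnectedSpace P] {Sigma : Set ℕ} {g : ℕ}

/-- **Row F-2827 `EdgeLikeSeparatingCoverings` (`V' := V`) at EVERY two-component one-node datum with BOTH
components unmarked** (`Π` a pro-`Σ` completion of the closed surface group `Γ_{g,0}`, node group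
`Π_ν = cl ι⟨ε⟩`, `ε = ∏_{i<g₀}[a_i,b_i]`, `g₀ ≥ 1`, `g − g₀ ≥ 1`; no cusps, so the only edge pairs are the
pairs of distinct LEVEL nodes over the one node): by the node twist.  The carriers WITH cusps / free factors are
abc-iut-f-164's / abc-iut-f-166's `edgeLikeSeparatingCoverings_of_twoComponent*`; nothing of those is restated.
[cite: MochizukiCombGC2007, Prop 1.2 proof p.9] -/
theorem edgeLikeSeparatingCoverings_of_twoComponentClosed (hne : Sigma.Nonempty)
    (hprime : ∀ p ∈ Sigma, p.Prime) (ι : PuncturedSurfaceGroup g 0 →* P)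
    (hι : IsProSigmaCompletion Sigma ι) (G : PSCDatum P) {g₀ : ℕ} (hg₀ : 1 ≤ g₀) (hg₁ : 1 ≤ g - g₀)
    (e : G.graph.C ≃ Fin 0) (n₀ : G.graph.N) (hN : ∀ n, n = n₀) (ε : PuncturedSurfaceGroup g 0)
    (hε : ε = ((List.finRange 0).map fun j : Fin 0 =>
        if 0 ≤ (j : ℕ) then PuncturedSurfaceGroup.c (g := g) j else 1).prod *
      ((List.finRange g).map fun i : Fin g => if (i : ℕ) < g₀ then
        PuncturedSurfaceGroup.a (r := 0) i * PuncturedSurfaceGroup.b i *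
          (PuncturedSurfaceGroup.a i)⁻¹ * (PuncturedSurfaceGroup.b i)⁻¹ else 1).prod)
    (hE : G.nodeGp n₀ = ((Subgroup.zpowers ε).map ι).topologicalClosure) :
    G.EdgeLikeSeparatingCoverings := by
  classical
  obtain ⟨ℓ, hℓS⟩ := hne
  have hℓ : ℓ.Prime := hprime ℓ hℓS
  have hx : ε = ((List.finRange g).map fun i : Fin g => if (i : ℕ) < g₀ then
      a (r := 0) i * b i * (a i)⁻¹ * (b i)⁻¹ else 1).prod := by
    rw [hε, List.finRange_zero, List.map_nil, List.prod_nil, one_mul]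
  intro V hVn hVo
  haveI := hVn
  refine ⟨V, hVn, hVo, le_rfl, fun e₁ e₂ γ₁ γ₂ hdist => ?_⟩
  rcases e₁ with n₁ | c₁
  · rcases e₂ with n₂ | c₂
    · obtain rfl : n₁ = n₀ := hN n₁
      obtain rfl : n₂ = n₁ := hN n₂
      have hne' : DoubleCoset.doubleCoset (ConjAct.ofConjAct γ₁) (V : Set P) (G.nodeGp n₂ : Set P) ≠
          DoubleCoset.doubleCoset (ConjAct.ofConjAct γ₂) (V : Set P) (G.nodeGp n₂ : Set P) := by
        rcases hdist with h | h
        · exact absurd rfl h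
        · exact h
      exact nodeTwist_exists_open_separating_sameNode hι hg₀ (by omega) ε hx hℓ hℓS (G.nodeGp n₂) hE V hVo
        γ₁ γ₂ hne'
    · exact (e c₂).elim0
  · exact (e c₁).elim0

/-- **Row F-2829 `SeparatingCoverings` — all three separating-coverings clauses — at every two-component
one-node datum with BOTH components unmarked**: F-2826 (vertices; abc-iut-w5-d183's vertex twist,
`verticialSeparatingCoverings_of_twoComponentClosed`), F-2827 (the node; this file) and F-2828 (`Π^unr`,
abc-iut-f-164's `unrRows_of_twoComponent`). [cite: MochizukiCombGC2007, Prop 1.2 proof p.9] -/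
theorem separatingCoverings_of_twoComponentClosed (hne : Sigma.Nonempty)
    (hprime : ∀ p ∈ Sigma, p.Prime) (ι : PuncturedSurfaceGroup g 0 →* P)
    (hι : IsProSigmaCompletion Sigma ι) (G : PSCDatum P) {g₀ : ℕ} (hg₀ : 1 ≤ g₀) (hg₁ : 1 ≤ g - g₀)
    (e : G.graph.C ≃ Fin 0) (n₀ : G.graph.N) (hN : ∀ n, n = n₀)
    (v₀ v₁ : G.graph.V) (hV : ∀ w, w = v₀ ∨ w = v₁) (ε : PuncturedSurfaceGroup g 0)
    (hε : ε = ((List.finRange 0).map fun j : Fin 0 =>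
        if 0 ≤ (j : ℕ) then PuncturedSurfaceGroup.c (g := g) j else 1).prod *
      ((List.finRange g).map fun i : Fin g => if (i : ℕ) < g₀ then
        PuncturedSurfaceGroup.a (r := 0) i * PuncturedSurfaceGroup.b i *
          (PuncturedSurfaceGroup.a i)⁻¹ * (PuncturedSurfaceGroup.b i)⁻¹ else 1).prod)
    (hV₀ : G.vertGp v₀ = ((Subgroup.closure {x : PuncturedSurfaceGroup g 0 |
        (∃ i : Fin g, (i : ℕ) < g₀ ∧ (x = PuncturedSurfaceGroup.a i ∨ x = PuncturedSurfaceGroup.b i)) ∨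
        ∃ j : Fin 0, 0 ≤ (j : ℕ) ∧ x = PuncturedSurfaceGroup.c j}).map ι).topologicalClosure)
    (hV₁ : G.vertGp v₁ = ((Subgroup.closure {x : PuncturedSurfaceGroup g 0 |
        (∃ i : Fin g, g₀ ≤ (i : ℕ) ∧ (x = PuncturedSurfaceGroup.a i ∨ x = PuncturedSurfaceGroup.b i)) ∨
        (∃ j : Fin 0, (j : ℕ) < 0 ∧ x = PuncturedSurfaceGroup.c j) ∨ x = ε}).map ι).topologicalClosure)
    (hE : G.nodeGp n₀ = ((Subgroup.zpowers ε).map ι).topologicalClosure)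
    (hgen₀ : G.genus v₀ = g₀) (hgen₁ : G.genus v₁ = g - g₀) :
    G.SeparatingCoverings :=
  ⟨G.verticialSeparatingCoverings_of_twoComponentClosed hne hprime ι hι hg₀ hg₁ v₀ v₁ hV ε hε hV₀ hV₁,
    G.edgeLikeSeparatingCoverings_of_twoComponentClosed hne hprime ι hι hg₀ hg₁ e n₀ hN ε hε hE,
    (G.unrRows_of_twoComponent hne hprime ι hι e (fun c' => (e c').elim0) n₀ hN v₀ v₁ hV ε hε hV₀ hV₁ hE
      hgen₀ hgen₁).1⟩

/-- **[CombGC] Prop. 1.2 (i) and (ii), ALL typed clauses, at every two-component one-node datum with BOTH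
components unmarked**: (i) verticial / edge-like / `Π^unr`-verticial open intersections determine the component;
(ii) verticial AND EDGE-LIKE subgroups (the node `cl ι⟨ε⟩` included) are commensurably terminal in `Π_G`, and
unramified verticial subgroups in `Π^unr_G` (`prop12_of_separating`). [cite: MochizukiCombGC2007, Prop 1.2 pp.8-9] -/
theorem prop12_of_twoComponentClosed (hne : Sigma.Nonempty)
    (hprime : ∀ p ∈ Sigma, p.Prime) (ι : PuncturedSurfaceGroup g 0 →* P)
    (hι : IsProSigmaCompletion Sigma ι) (G : PSCDatum P) {g₀ : ℕ} (hg₀ : 1 ≤ g₀) (hg₁ : 1 ≤ g - g₀)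
    (e : G.graph.C ≃ Fin 0) (n₀ : G.graph.N) (hN : ∀ n, n = n₀)
    (v₀ v₁ : G.graph.V) (hV : ∀ w, w = v₀ ∨ w = v₁) (ε : PuncturedSurfaceGroup g 0)
    (hε : ε = ((List.finRange 0).map fun j : Fin 0 =>
        if 0 ≤ (j : ℕ) then PuncturedSurfaceGroup.c (g := g) j else 1).prod *
      ((List.finRange g).map fun i : Fin g => if (i : ℕ) < g₀ then
        PuncturedSurfaceGroup.a (r := 0) i * PuncturedSurfaceGroup.b i *
          (PuncturedSurfaceGroup.a i)⁻¹ * (PuncturedSurfaceGroup.b i)⁻¹ else 1).prod)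
    (hV₀ : G.vertGp v₀ = ((Subgroup.closure {x : PuncturedSurfaceGroup g 0 |
        (∃ i : Fin g, (i : ℕ) < g₀ ∧ (x = PuncturedSurfaceGroup.a i ∨ x = PuncturedSurfaceGroup.b i)) ∨
        ∃ j : Fin 0, 0 ≤ (j : ℕ) ∧ x = PuncturedSurfaceGroup.c j}).map ι).topologicalClosure)
    (hV₁ : G.vertGp v₁ = ((Subgroup.closure {x : PuncturedSurfaceGroup g 0 |
        (∃ i : Fin g, g₀ ≤ (i : ℕ) ∧ (x = PuncturedSurfaceGroup.a i ∨ x = PuncturedSurfaceGroup.b i)) ∨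
        (∃ j : Fin 0, (j : ℕ) < 0 ∧ x = PuncturedSurfaceGroup.c j) ∨ x = ε}).map ι).topologicalClosure)
    (hE : G.nodeGp n₀ = ((Subgroup.zpowers ε).map ι).topologicalClosure)
    (hgen₀ : G.genus v₀ = g₀) (hgen₁ : G.genus v₁ = g - g₀) :
    (G.VerticialOpenInterDeterminesVertex ∧ G.EdgeLikeOpenInterDeterminesEdge ∧
      G.UnrVerticialOpenInterDeterminesVertex) ∧
    (G.VerticialEdgeLikeCommensurablyTerminal ∧ G.UnrVerticialCommensurablyTerminal) :=
  G.prop12_of_separating (G.separatingCoverings_of_twoComponentClosed hne hprime ι hι hg₀ hg₁ e n₀ hN v₀ v₁ hV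
    ε hε hV₀ hV₁ hE hgen₀ hgen₁)

/-! ### Origin level: F-0438 (in full), F-0459, F-2830 at every origin of two-closed-components data -/

/-- **F-0438 `CommensurableTerminalityHolds Ω` (BOTH clauses), F-0459 `OpenInterDeterminesComponentHolds Ω`
and F-2830 `SeparatingCoveringsHolds Ω` at EVERY origin whose data are two-component one-node data with both
components unmarked** (hypothesis shape of `exists_twoComponentAffineDatum` at `r = 0`, `s = 0`, profinite `Π` in
`Type`, with the node and genus pins — the shape of abc-iut-w5-d183's `openInterDeterminesComponentHolds_of_twoComponentClosed`).
[cite: MochizukiCombGC2007, Prop 1.2 pp.8-9] -/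
theorem twoComponentClosedOrigin_prop12_rows (Ω : PSCOrigin.{0})
    (hΩ : ∀ ⦃Q : Type⦄ [Group Q] [TopologicalSpace Q] [IsTopologicalGroup Q] (G : PSCDatum Q),
      Ω.IsOfPSCType G → CompactSpace Q ∧ TotallyDisconnectedSpace Q ∧
        ∃ (S : Set ℕ) (g g₀ : ℕ) (ι : PuncturedSurfaceGroup g 0 →* Q) (e : G.graph.C ≃ Fin 0)
          (v₀ v₁ : G.graph.V) (n₀ : G.graph.N) (ε : PuncturedSurfaceGroup g 0),
          S.Nonempty ∧ (∀ p ∈ S, p.Prime) ∧ IsProSigmaCompletion S ι ∧ 1 ≤ g₀ ∧ 1 ≤ g - g₀ ∧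
          (∀ c, G.cuspGp c =
            ((PuncturedSurfaceGroup.cuspInertia (g := g) (e c)).map ι).topologicalClosure) ∧
          (∀ w, w = v₀ ∨ w = v₁) ∧ (∀ n, n = n₀) ∧
          ε = ((List.finRange 0).map fun j : Fin 0 =>
            if 0 ≤ (j : ℕ) then PuncturedSurfaceGroup.c (g := g) j else 1).prod *
          ((List.finRange g).map fun i : Fin g => if (i : ℕ) < g₀ then
            PuncturedSurfaceGroup.a (r := 0) i * PuncturedSurfaceGroup.b i *
              (PuncturedSurfaceGroup.a i)⁻¹ * (PuncturedSurfaceGroup.b i)⁻¹ else 1).prod ∧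
          G.vertGp v₀ = ((Subgroup.closure {x : PuncturedSurfaceGroup g 0 |
            (∃ i : Fin g, (i : ℕ) < g₀ ∧ (x = PuncturedSurfaceGroup.a i ∨ x = PuncturedSurfaceGroup.b i)) ∨
            ∃ j : Fin 0, 0 ≤ (j : ℕ) ∧ x = PuncturedSurfaceGroup.c j}).map ι).topologicalClosure ∧
          G.vertGp v₁ = ((Subgroup.closure {x : PuncturedSurfaceGroup g 0 |
            (∃ i : Fin g, g₀ ≤ (i : ℕ) ∧ (x = PuncturedSurfaceGroup.a i ∨ x = PuncturedSurfaceGroup.b i)) ∨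
            (∃ j : Fin 0, (j : ℕ) < 0 ∧ x = PuncturedSurfaceGroup.c j) ∨ x = ε}).map ι).topologicalClosure ∧
          G.nodeGp n₀ = ((Subgroup.zpowers ε).map ι).topologicalClosure ∧
          G.genus v₀ = g₀ ∧ G.genus v₁ = g - g₀) :
    CommensurableTerminalityHolds Ω ∧ OpenInterDeterminesComponentHolds Ω ∧ SeparatingCoveringsHolds Ω := by
  have hsep : SeparatingCoveringsHolds Ω := by
    intro Q _ _ _ G hG
    obtain ⟨hc, hd, S, g, g₀, ι, e, v₀, v₁, n₀, ε, hne, hprime, hι, hg₀, hg₁, -, hV, hN, hε, hV₀, hV₁, hE,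
      hgen₀, hgen₁⟩ := hΩ G hG
    haveI := hc
    haveI := hd
    exact G.separatingCoverings_of_twoComponentClosed hne hprime ι hι hg₀ hg₁ e n₀ hN v₀ v₁ hV ε hε hV₀ hV₁ hE
      hgen₀ hgen₁
  have hprof : ∀ ⦃Q : Type⦄ [Group Q] [TopologicalSpace Q] [IsTopologicalGroup Q] (G : PSCDatum Q),
      Ω.IsOfPSCType G → CompactSpace Q ∧ TotallyDisconnectedSpace Q := fun Q _ _ _ G hG => by
    obtain ⟨hc, hd, -⟩ := hΩ G hG
    exact ⟨hc, hd⟩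
  exact ⟨commensurableTerminalityHolds_of_separating Ω hsep hprof,
    openInterDeterminesComponentHolds_of_separating Ω hsep hprof, hsep⟩

/-- **Non-vacuity: at the inhabited origin of two-component data with both components unmarked — for every
nonempty set `Σ` of primes and all genera `g₀, g₁ ≥ 1` (at `g₀ = g₁ = 1`: the unpointed genus-2 curve breaking
into two elliptic tails, `Δ₁ ⊂ ∂M̄₂`) — F-0438 ([CombGC] Prop. 1.2 (ii), BOTH clauses: the node is commensurably
terminal), F-0459 (Prop. 1.2 (i), all three clauses) and F-2830 (the separating coverings of the proof of
Prop. 1.2, all three cases) ALL HOLD**, the inhabitant being abc-iut-f-164's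
`exists_twoComponentAffineDatum Σ … (g₀ + g₁) 0 g₀ 0` over a pro-`Σ` completion of the closed surface group
`Γ_{g₀+g₁,0}`. [cite: MochizukiCombGC2007, Prop 1.2 pp.8-9] -/
theorem exists_twoComponentClosedOrigin_prop12_holds_all (Sigma : Set ℕ) (hne : Sigma.Nonempty)
    (hprime : ∀ p ∈ Sigma, p.Prime) {g₀ g₁ : ℕ} (hg₀ : 1 ≤ g₀) (hg₁ : 1 ≤ g₁) :
    ∃ Ω : PSCOrigin.{0},
      (∃ (Q : ProfiniteGrp.{0}) (ι : PuncturedSurfaceGroup (g₀ + g₁) 0 →* Q) (G : PSCDatum Q)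
        (v₀ v₁ : G.graph.V),
        IsProSigmaCompletion Sigma ι ∧ Ω.IsOfPSCType G ∧ G.Sigma = Sigma ∧ G.graph.i = 2 ∧ G.graph.n = 1 ∧
          G.graph.r = 0 ∧ (∀ w, w = v₀ ∨ w = v₁) ∧ G.genus v₀ = g₀ ∧ G.genus v₁ = g₁) ∧
      CommensurableTerminalityHolds Ω ∧ OpenInterDeterminesComponentHolds Ω ∧ SeparatingCoveringsHolds Ω := by
  classical
  let Ω : PSCOrigin.{0} :=
    ⟨fun {Q} _ _ G => ∃ (_ : IsTopologicalGroup Q), CompactSpace Q ∧ TotallyDisconnectedSpace Q ∧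
        ∃ (S : Set ℕ) (g g₀ : ℕ) (ι : PuncturedSurfaceGroup g 0 →* Q) (e : G.graph.C ≃ Fin 0)
          (v₀ v₁ : G.graph.V) (n₀ : G.graph.N) (ε : PuncturedSurfaceGroup g 0),
          S.Nonempty ∧ (∀ p ∈ S, p.Prime) ∧ IsProSigmaCompletion S ι ∧ 1 ≤ g₀ ∧ 1 ≤ g - g₀ ∧
          (∀ c, G.cuspGp c =
            ((PuncturedSurfaceGroup.cuspInertia (g := g) (e c)).map ι).topologicalClosure) ∧
          (∀ w, w = v₀ ∨ w = v₁) ∧ (∀ n, n = n₀) ∧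
          ε = ((List.finRange 0).map fun j : Fin 0 =>
            if 0 ≤ (j : ℕ) then PuncturedSurfaceGroup.c (g := g) j else 1).prod *
          ((List.finRange g).map fun i : Fin g => if (i : ℕ) < g₀ then
            PuncturedSurfaceGroup.a (r := 0) i * PuncturedSurfaceGroup.b i *
              (PuncturedSurfaceGroup.a i)⁻¹ * (PuncturedSurfaceGroup.b i)⁻¹ else 1).prod ∧
          G.vertGp v₀ = ((Subgroup.closure {x : PuncturedSurfaceGroup g 0 |
            (∃ i : Fin g, (i : ℕ) < g₀ ∧ (x = PuncturedSurfaceGroup.a i ∨ x = PuncturedSurfaceGroup.b i)) ∨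
            ∃ j : Fin 0, 0 ≤ (j : ℕ) ∧ x = PuncturedSurfaceGroup.c j}).map ι).topologicalClosure ∧
          G.vertGp v₁ = ((Subgroup.closure {x : PuncturedSurfaceGroup g 0 |
            (∃ i : Fin g, g₀ ≤ (i : ℕ) ∧ (x = PuncturedSurfaceGroup.a i ∨ x = PuncturedSurfaceGroup.b i)) ∨
            (∃ j : Fin 0, (j : ℕ) < 0 ∧ x = PuncturedSurfaceGroup.c j) ∨ x = ε}).map ι).topologicalClosure ∧
          G.nodeGp n₀ = ((Subgroup.zpowers ε).map ι).topologicalClosure ∧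
          G.genus v₀ = g₀ ∧ G.genus v₁ = g - g₀⟩
  refine ⟨Ω, ?_, twoComponentClosedOrigin_prop12_rows Ω fun Q _ _ _ G hG => hG.2⟩
  obtain ⟨Q, ι, G, e, v₀, v₁, n₀, ε, hι, hS, hi, hn, hr, hC, hV, hN, hε, hV₀, hV₁, hE, hgen₀, hgen₁, -⟩ :=
    exists_twoComponentAffineDatum Sigma hne hprime (g₀ + g₁) 0 g₀ 0
  have hG : Ω.IsOfPSCType G := ⟨inferInstance, inferInstance, inferInstance, Sigma, g₀ + g₁, g₀, ι, e, v₀, v₁,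
    n₀, ε, hne, hprime, hι, hg₀, by omega, hC, hV, hN, hε, hV₀, hV₁, hE, hgen₀, hgen₁⟩
  exact ⟨Q, ι, G, v₀, v₁, hι, hG, hS, hi, hn, hr, hV, hgen₀, by rw [hgen₁]; omega⟩

end PSCDatum

end Literature.AnabelianGeometry.SemiGraphs
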